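import Summits.BirchSwinnertonDyer.BirchSwinnertonDyer.Theorems.PrintCf2RubinValueTwoEllipticUnitsLocalRelation
import HarnessLib

/-!
# Brick (c) at `p = 2`, module M-TOP of the second pair, (L3) input: the VALUE RELATIONS of the swap–transport identity from de Shalit II.2.4 (ii) —
# `(g̃·t) • y_𝔠 · (t • y_𝔞)^{N𝔠} = t • y_{𝔞𝔠}` for EVERY `t ∈ Γ_K`, `g̃` any lift of `(𝔞, K(𝔪)/K)`

Cell `bsd-print-cf2`, width seat `bsd-line-cf2c-w7` g27, route C `PrintCf2RubinValueTwo`, crux of record stmt-BirchSwinnertonDyer-24033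
`TwoVariableMainConjAtSplitTwoQuad` (23720 nominal), BRICK §4(c); memo v5 `Cruxes/TwoVariableMainConjAtSplitTwoQuad/BRICK-C-D4CHI-g27.md` §5 (L3).
These are the hypotheses `hval₁` / `hval₂` of `…BrickCD4ChiMultiplierOnGenerators.sub_mul_phi_averaged_eq_sub_mul_phi_averaged`, read in ONE abelian layer
`K(𝔪)` (apply with `𝔪 := 𝔪_i·v^{k+1}`).  Ingredients: -w4 g10's `isThetaValueOne_algClosureEmb_artin_mul_pow` (II.2.4 (ii) GIVEN the named fact
`DeShalit1987.prop24_ii_galoisAction`), well-definedness `isThetaValueOne_unique`, injectivity of `ι̂`, and the commutativity of `Gal(K(𝔪)/K)`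
(`(t·g̃)|_{K(𝔪)} = (g̃·t)|_{K(𝔪)}`).

* ★ `smul_mul_smul_pow_eq_smul_of_rel` — abelian bookkeeping: `g̃ • y₁ · y₂^N = y₃` in an abelian layer ⟹ `(g̃t) • y₁ · (t • y₂)^N = t • y₃` for all `t`.
* ★★ `artin_smul_mul_pow_eq_of_isThetaValueOne` — `σ_𝔞 y_𝔠 · y_𝔞^{N𝔠} = y_{𝔞𝔠}` in `K(𝔪)` for Θ(1)-values (GIVEN II.2.4 (ii)).
* ★★★ `smul_mul_smul_pow_eq_smul_of_isThetaValueOne` — the value relation for every `t ∈ Γ_K` and any lift `g̃` of `σ_𝔞`.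
THEOREMS ONLY (0 sorry, no new definitions); CONDITIONAL on the published named fact `DeShalit1987.prop24_ii_galoisAction` where stated (hypothesis, never
asserted).  BSD is not proved by any of this; nothing here closes 24033 or 27037.

## References
* [deShalit1987] E. de Shalit, *Iwasawa theory of elliptic curves with complex multiplication* (1987), II §2.3 (10), §2.4 Proposition (ii), §4.12 (p. 66).
* [NeukirchANT1999] J. Neukirch, *Algebraic Number Theory* (1999), Ch. VI §7 (7.1).
-/

noncomputable section

set_option linter.dupNamespace false
set_option autoImplicit false

open scoped NumberField

namespace Summit.BirchSwinnertonDyer.BirchSwinnertonDyer.Theorems.PrintCf2.BrickCD4Chi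

open Field IsDedekindDomain IsDedekindDomain.HeightOneSpectrum ValuativeRel
open Literature.NumberTheory.NumberFields
open Literature.NumberTheory.GaloisRepresentations Literature.NumberTheory.GaloisRepresentations.IsNonarchimedeanLocalField
open Literature.NumberTheory.EllipticCurves
open Literature.NumberTheory.ComplexMultiplication.EllipticUnits
open Literature.NumberTheory.LFunctions.AbelianDensity (artinSymbol)
open Summit.BirchSwinnertonDyer.BirchSwinnertonDyer.Theorems.PrintCf2.LeopoldtAtV
open Summit.BirchSwinnertonDyer.BirchSwinnertonDyer.Theorems.PrintCf2.EllipticUnitsLocal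

variable {K : Type} [Field K] [NumberField K]

/-! ## §1. Abelian bookkeeping -/

omit [NumberField K] in
/-- `((ρ|_L) y : K̄) = ρ • y` (bookkeeping). [folklore] -/
private theorem coe_absRestrictNormalHom_apply₃₁ (L : IntermediateField K (AlgebraicClosure K)) [Normal K L]
    (ρ : absoluteGaloisGroup K) (y : L) :
    ((absRestrictNormalHom L ρ y : L) : AlgebraicClosure K) = ρ • (y : AlgebraicClosure K) :=
  AlgEquiv.restrictNormalHom_apply L _ y

omit [NumberField K] in
/-- In an abelian layer the factors commute: `(a·b) • y = (b·a) • y` for `y ∈ L`. [folklore] -/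
theorem mul_smul_eq_mul_smul_of_mem (L : IntermediateField K (AlgebraicClosure K)) [Normal K L] [IsAbelianGalois K L]
    {y : AlgebraicClosure K} (hy : y ∈ L) (a b : absoluteGaloisGroup K) : (a * b) • y = (b * a) • y := by
  have hcomm : ∀ s s' : L ≃ₐ[K] L, s * s' = s' * s := fun s s' ↦ IsMulCommutative.is_comm.comm s s'
  rw [← coe_absRestrictNormalHom_apply₃₁ L (a * b) ⟨y, hy⟩, ← coe_absRestrictNormalHom_apply₃₁ L (b * a) ⟨y, hy⟩, map_mul, map_mul,
    hcomm]

omit [NumberField K] in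
/-- ★ **Abelian bookkeeping**: if `g̃ • y₁ · y₂^N = y₃` with `y₁ ∈ L`, `L/K` abelian, then `(g̃·t) • y₁ · (t • y₂)^N = t • y₃` for every `t ∈ Γ_K`
(apply `t`, and `t g̃ ≡ g̃ t` on `L`). [cite: deShalit1987, II §4.12 (p. 66)] -/
theorem smul_mul_smul_pow_eq_smul_of_rel (L : IntermediateField K (AlgebraicClosure K)) [Normal K L] [IsAbelianGalois K L]
    {y₁ y₂ y₃ : AlgebraicClosure K} (hy₁ : y₁ ∈ L) (g t : absoluteGaloisGroup K) {N : ℕ} (h : g • y₁ * y₂ ^ N = y₃) :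
    (g * t) • y₁ * (t • y₂) ^ N = t • y₃ := by
  rw [← h, smul_mul', smul_pow', ← mul_smul, mul_smul_eq_mul_smul_of_mem L hy₁ t g]

/-! ## §2. The value relation from de Shalit II.2.4 (ii) -/

/-- ★★ **`σ_𝔞 y_𝔠 · y_𝔞^{N𝔠} = y_{𝔞𝔠}` in `K(𝔪)`** for Θ(1)-values `y_𝔞, y_𝔠, y_{𝔞𝔠}` (`IsThetaValueOne ι 𝔪 ·`), `K` imaginary quadratic, `𝔪 ≠ 0, 𝒪_K`,
`𝔞, 𝔠 ≠ 0` prime to `𝔪` — GIVEN II.2.4 (ii) (`isThetaValueOne_algClosureEmb_artin_mul_pow`, well-definedness, `ι̂` injective).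
[cite: deShalit1987, II §2.3 (10), §2.4 Proposition (ii)] -/
theorem artin_smul_mul_pow_eq_of_isThetaValueOne (h24ii : DeShalit1987.prop24_ii_galoisAction) (hK : IsImaginaryQuadratic K) (ι : K →+* ℂ)
    {𝔪 𝔞 𝔠 : Ideal (𝓞 K)} (h𝔪0 : 𝔪 ≠ ⊥) (h𝔪1 : 𝔪 ≠ ⊤) (h𝔞0 : 𝔞 ≠ ⊥) (h𝔞 : IsCoprime 𝔞 𝔪) (h𝔠0 : 𝔠 ≠ ⊥) (h𝔠 : IsCoprime 𝔠 𝔪)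
    {ya yc yac : rayClassField K 𝔪} (hya : IsThetaValueOne ι 𝔪 𝔞 (algClosureEmb ι (ya : AlgebraicClosure K)))
    (hyc : IsThetaValueOne ι 𝔪 𝔠 (algClosureEmb ι (yc : AlgebraicClosure K)))
    (hyac : IsThetaValueOne ι 𝔪 (𝔞 * 𝔠) (algClosureEmb ι (yac : AlgebraicClosure K))) :
    ((artinSymbol (galFrob K (rayClassField K 𝔪)) 𝔞 yc : rayClassField K 𝔪) : AlgebraicClosure K) * (ya : AlgebraicClosure K) ^ Ideal.absNorm 𝔠 =
      (yac : AlgebraicClosure K) := by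
  apply (algClosureEmb ι).injective
  rw [map_mul, map_pow]
  have h1 := isThetaValueOne_algClosureEmb_artin_mul_pow h24ii hK ι h𝔪0 h𝔪1 h𝔠0 h𝔠 h𝔞0 h𝔞 hyc hya
  rw [mul_comm 𝔠 𝔞] at h1
  exact isThetaValueOne_unique h𝔪1 h1 hyac

/-- ★★★ **THE VALUE RELATION for every `t ∈ Γ_K`**: with `g̃ ∈ Γ_K` restricting to `(𝔞, K(𝔪)/K)` on `K(𝔪)`,
**`(g̃·t) • y_𝔠 · (t • y_𝔞)^{N𝔠} = t • y_{𝔞𝔠}`** — the hypothesis `hval` of the swap–transport identity (`…SwapTransport`, `…MultiplierOnGenerators`)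
on the layer `K(𝔪)`, GIVEN II.2.4 (ii). [cite: deShalit1987, II §2.4 Proposition (ii), §4.12 (p. 66)] [cite: NeukirchANT1999, Ch. VI §7 (7.1)] -/
theorem smul_mul_smul_pow_eq_smul_of_isThetaValueOne (h24ii : DeShalit1987.prop24_ii_galoisAction) (hK : IsImaginaryQuadratic K) (ι : K →+* ℂ)
    {𝔪 𝔞 𝔠 : Ideal (𝓞 K)} (h𝔪0 : 𝔪 ≠ ⊥) (h𝔪1 : 𝔪 ≠ ⊤) (h𝔞0 : 𝔞 ≠ ⊥) (h𝔞 : IsCoprime 𝔞 𝔪) (h𝔠0 : 𝔠 ≠ ⊥) (h𝔠 : IsCoprime 𝔠 𝔪)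
    {ya yc yac : rayClassField K 𝔪} (hya : IsThetaValueOne ι 𝔪 𝔞 (algClosureEmb ι (ya : AlgebraicClosure K)))
    (hyc : IsThetaValueOne ι 𝔪 𝔠 (algClosureEmb ι (yc : AlgebraicClosure K)))
    (hyac : IsThetaValueOne ι 𝔪 (𝔞 * 𝔠) (algClosureEmb ι (yac : AlgebraicClosure K)))
    {g : absoluteGaloisGroup K} (hg : absRestrictNormalHom (rayClassField K 𝔪) g = artinSymbol (galFrob K (rayClassField K 𝔪)) 𝔞)
    (t : absoluteGaloisGroup K) :
    (g * t) • (yc : AlgebraicClosure K) * (t • (ya : AlgebraicClosure K)) ^ Ideal.absNorm 𝔠 = t • (yac : AlgebraicClosure K) := by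
  haveI : IsAbelianGalois K (rayClassField K 𝔪) := inferInstance
  refine smul_mul_smul_pow_eq_smul_of_rel (rayClassField K 𝔪) yc.2 g t ?_
  rw [← coe_absRestrictNormalHom_apply₃₁ (rayClassField K 𝔪) g yc, hg]
  exact artin_smul_mul_pow_eq_of_isThetaValueOne h24ii hK ι h𝔪0 h𝔪1 h𝔞0 h𝔞 h𝔠0 h𝔠 hya hyc hyac

end Summit.BirchSwinnertonDyer.BirchSwinnertonDyer.Theorems.PrintCf2.BrickCD4Chi

end
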